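import Literature.NumberTheory.ComplexMultiplication.NondegenerateCMTypesImaginaryQuadraticSubfield
import HarnessLib

/-!
# The reflex type of a CM type with a special element is the type itself, read through `σ₀`:
# `(K*, Φ*) = (σ₀(K), Φ ∘ σ₀⁻¹)` (DIS Props. 16–18 in full; Howard 2012 §3.1)

Layer `Literature/NumberTheory/ComplexMultiplication`, namespace `Literature.NumberTheory.ComplexMultiplication` (lane
`lit-hodgefound`, Track 2 foundations, Layer A3; seat `lit-hodgefound-p11`, generation 25, row g25-#9).  Sequel of
`CMTypeSpecialElementReflexField` (g25-#6: the reflex FIELD of a type with a special element is `σ₀(K)`).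
THEOREMS ONLY: no definition, no named fact (D-0026), net Literature debt 0.

THE PRINT.  B. Dina, S. Ionica, J. Sijsling (2022) [DinaIonicaSijsling2022], §1.3, for sextic CM fields with an
imaginary quadratic subfield: Prop. 16 (`C₆`) «We have `(K^r, Φ^r) = (K, Φ)` for all primitive CM types `Φ`»;
Prop. 17 «the reflex CM type of `(K, σΦ)` is given by `(σ(K^r), Φ^r σ⁻¹)`»; Prop. 18 (`D₆`) «`(K₁^r, Φ₁^r) = (K, Φ)`,
`(K₂^r, Φ₂^r) = (σ(K), Φσ⁻¹)`, `(K₃^r, Φ₃^r) = (σ⁻¹(K), Φσ)`», with the proof «the lift of the CM type `Φ` to `L` is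
given by `Φ_L = {e, τ, σ, στ, σ⁻¹, σ⁻¹τ}`, so that `Φ_L⁻¹ = Φ_L`.  This implies that the reflex of `(K, Φ)` is given by
`(K, Φ)` itself.»  B. Howard (2012) [Howard2012], §3.1 («we may take `K_Φ = φ^sp(K)`»).  G. Shimura (1998)
[Shimura1998], §8.3 Prop. 28 (the reflex `(K*; {ψ_α})`: «`S*` the set of inverses of the elements of `S` … `ψ_α`
the distinct isomorphisms of `K*` into `ℂ` induced by the elements of `S*`»), §13.1 (7).

THE TREE'S MODEL.  `K` a CM field, `k₀ : IntermediateField ℚ K` imaginary quadratic, `Φ : CMType K` with special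
element `σ₀` (hypotheses `σ₀ ∈ Φ.1`, `∀ φ ∈ Φ.1, φ|_{k₀} = σ₀|_{k₀} → φ = σ₀`; g25-#6).  Shimura's lifted type and its
inverse are the tree's `typeLift Φ.1 σ₀ = {τ | τσ₀ ∈ Φ}` and `reflexLift Φ.1 σ₀ = {τ | τ⁻¹σ₀ ∈ Φ}` (`ReflexType`,
for `Aut(ℂ)` acting on `Hom(K, ℂ)`); Shimura's reflex type on a field `k` along `s : k → ℂ` seen from the base point
`τ` is `reflexTypeOn Φ.1 τ s = {g ∘ s | g⁻¹ ∘ τ ∈ Φ}` (`ShimuraTaniyamaHecke`); in a Galois model `L` (CM, Galois over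
`ℚ`, `j : K → L`, `ι : L → ℂ`) the reflex pair is `reflexField ℚ L Φ_L`, `reflexType ℚ L Φ_L j` (`ReflexPair`) and the
complex reflex type `reflexCMType ι Φ j` (`ReflexCMType`), `Φ_L = algValuedIn ι Φ.1`.

WHAT IS PROVED (all `sorry`-free).

§1 COMPLEX MODEL, ANY DEGREE: `smul_special_mem_iff_inv_smul_special_mem` — **`τσ₀ ∈ Φ ⟺ τ⁻¹σ₀ ∈ Φ`**, i.e.
   **`typeLift_eq_reflexLift_of_special`: `S = S⁻¹`** (DIS «`Φ_L⁻¹ = Φ_L`»); **`reflexTypeOn_special_self`: the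
   reflex type on `K` along `σ₀`, seen from `σ₀`, is `Φ` itself** («`(K^r, Φ^r) = (K, Φ)`»); `reflexTypeOn_smul_special`
   (seen from `aσ₀` it is the conjugate type `aΦ` — Prop. 17); for `[K : ℚ] ≥ 6`, where `K* = ℚ(tr_Φ(K)) = σ₀(K)`
   (g25-#6): **`reflexTypeOn_special_traceField`: the reflex type on `K* ⊂ ℂ` (along the inclusion, seen from `σ₀`)
   is `Φ` transported by `σ₀ : K ≅ K*`** — `{ψ : K* → ℂ | ψ ∘ σ₀ ∈ Φ}`, the carrier of `inducedCMType σ₀|^{K*} Φ`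
   («`(K₂^r, Φ₂^r) = (σ(K), Φσ⁻¹)`»).
§2 GALOIS MODEL (`[K : ℚ] ≥ 6` where marked): `typeLift_algValuedIn_eq_reflexLift_of_special` (`S(Φ_L, j) = S*`);
   `stabilizer_algValuedIn_eq_stabilizer_of_special` (`H* = Stab(j) = Gal(L/j(K))`);
   **`reflexField_algValuedIn_eq_fieldRange_of_special`: `K*_L = j(K)`**; `smul_val_mem_reflexType_iff_of_special`
   (`g|_{K*} ∈ Φ* ⟺ g ∘ j ∈ Φ_L`); **`reflexCMType_eq_inducedCMType_of_special`: `reflexCMType ι Φ j = inducedCMType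
   (j|^{K*}) Φ`** — the reflex CM type IS `Φ` carried to `K* = j(K)` by `j`.
§3 SEXTIC `K ⊇ k₀`: the same for every PRIMITIVE type (through its special element, g25-#6
   `exists_special_of_isPrimitive_sextic`).

## References

* [DinaIonicaSijsling2022] B. Dina, S. Ionica, J. Sijsling (2022), §1.3 Def. 15, Props. 16, 17, 18.
* [Howard2012] B. Howard, Ann. of Math. (2) 176 (2012), §3.1.
* [Shimura1998] G. Shimura, *Abelian Varieties with Complex Multiplication and Modular Functions*, §8.3 Prop. 28,
  §8.4 (1), §13.1 (7).
* [Streng2010] M. Streng, *Complex multiplication of abelian surfaces* (2010), Ch. I §7 (Def. 7.1, Lemma 7.2).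

## Provenance

Lane `lit-hodgefound` (HOME `run/shared/lean/pub/lit-hodgefound/`), prover seat `lit-hodgefound-p11` (gen 25),
self-proposed row g25-#9 (INBOX claim 2026-08-27, l.41219).
-/

set_option autoImplicit false

noncomputable section

open scoped Classical NumberField Pointwise
open NumberField Module IntermediateField

namespace Literature.NumberTheory.ComplexMultiplication

open Literature.AlgebraicGeometry.Motives (CMType)
open Literature.AlgebraicGeometry.Motives.HodgeStructure (cmTypeSmul cmTypeSmul_val)
open Literature.AlgebraicGeometry.Pohlmann1968 (isPretransitive_ringEquiv_complex)

/-! ## §1 Complex model: `S = S⁻¹`, and the reflex type read through `σ₀` -/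

section Complex

variable {K : Type} [Field K] [NumberField K] [IsCMField K] (k₀ : IntermediateField ℚ K) [IsTotallyComplex k₀]

omit [IsCMField K] [IsTotallyComplex k₀] in
/-- `(τφ)|_{k₀} = τ(φ|_{k₀})`. [folklore] -/
private theorem smul_comp_rt (τ : ℂ ≃+* ℂ) (φ : K →+* ℂ) :
    (τ • φ).comp (algebraMap k₀ K) = τ • φ.comp (algebraMap k₀ K) :=
  RingHom.ext fun _ => rfl

omit [IsCMField K] in
/-- `ῑ ≠ ι`. [folklore] -/
private theorem conjugate_ne_rt (ψ : k₀ →+* ℂ) : ComplexEmbedding.conjugate ψ ≠ ψ := fun h =>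
  IsTotallyComplex.complexEmbedding_not_isReal ψ (ComplexEmbedding.isReal_iff.2 h)

omit [IsCMField K] in
/-- Every embedding of the imaginary quadratic `k₀` is `ι` or `ῑ`. [cite: Shimura1998, §8.4 (1)] -/
private theorem eq_or_eq_conjugate_rt (hk₀ : finrank ℚ k₀ = 2) (ψ χ : k₀ →+* ℂ) :
    χ = ψ ∨ χ = ComplexEmbedding.conjugate ψ := by
  obtain ⟨Ψ₀, hΨ₀⟩ := exists_cmType_singleton k₀ hk₀ ψ
  by_cases h : χ = ψ
  · exact Or.inl h
  · right
    have hχ : χ ∉ Ψ₀.1 := by rw [hΨ₀]; exact h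
    have hc : ComplexEmbedding.conjugate χ ∈ Ψ₀.1 := by
      by_contra h'
      exact hχ ((Ψ₀.2 χ).2 h')
    rw [hΨ₀, Set.mem_singleton_iff] at hc
    rw [← hc]
    exact (ComplexEmbedding.involutive_conjugate _ χ).symm

/-- `τσ̄ = \overline{τσ}` on a CM field. [cite: Shimura1998, §18.2 Lemma (i)] -/
private theorem smul_conjugate_rt (τ : ℂ ≃+* ℂ) (φ : K →+* ℂ) :
    τ • ComplexEmbedding.conjugate φ = ComplexEmbedding.conjugate (τ • φ) := by
  refine RingHom.ext fun x => ?_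
  change τ (starRingEnd ℂ (φ x)) = starRingEnd ℂ (τ (φ x))
  rw [← IsCMField.complexEmbedding_complexConj K φ x]
  exact IsCMField.complexEmbedding_complexConj K ((τ : ℂ →+* ℂ).comp φ) x

/-- **`τσ₀ ∈ Φ ⟹ τ⁻¹σ₀ ∈ Φ`** for a type with special element `σ₀` (any degree): if `τσ₀ ≠ σ₀` then `τ` swaps the two
embeddings `ι, ῑ` of `k₀`, so `τ⁻¹σ₀` lies above `ῑ`, and `τ⁻¹σ₀ ≠ σ̄₀` because `τσ₀ ≠ σ̄₀`.
[cite: DinaIonicaSijsling2022, §1.3 Prop. 18 (proof: «`Φ_L⁻¹ = Φ_L`»)] [cite: Howard2012, §3.1] -/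
theorem inv_smul_special_mem_of_smul_special_mem (hk₀ : finrank ℚ k₀ = 2) {Φ : CMType K} {σ₀ : K →+* ℂ}
    (hσ₀ : σ₀ ∈ Φ.1) (hsp : ∀ φ ∈ Φ.1, φ.comp (algebraMap k₀ K) = σ₀.comp (algebraMap k₀ K) → φ = σ₀)
    {τ : ℂ ≃+* ℂ} (hτ : τ • σ₀ ∈ Φ.1) : τ⁻¹ • σ₀ ∈ Φ.1 := by
  rcases (mem_iff_of_special k₀ hk₀ hσ₀ hsp (τ • σ₀)).1 hτ with h | ⟨hres, hbar⟩
  · -- `τσ₀ = σ₀`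
    have h' : τ⁻¹ • σ₀ = σ₀ := by
      conv_lhs => rw [← h]
      rw [inv_smul_smul]
    rw [h']
    exact hσ₀
  · refine (mem_iff_of_special k₀ hk₀ hσ₀ hsp (τ⁻¹ • σ₀)).2 (Or.inr ⟨fun hc => ?_, fun hc => ?_⟩)
    · -- `τ` maps `ι ↦ ῑ`, hence `ῑ ↦ ι`, so `τ⁻¹ι = ῑ ≠ ι`
      rw [smul_comp_rt] at hres hc
      -- `hc : τ⁻¹ι = ι` gives `τι = ι`, contradicting `hres`
      apply hres
      have := congrArg (fun e => τ • e) hc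
      simp only [smul_inv_smul] at this
      exact this.symm
    · -- `τ⁻¹σ₀ = σ̄₀` gives `σ₀ = τσ̄₀ = \overline{τσ₀}`, i.e. `τσ₀ = σ̄₀`
      apply hbar
      have h1 : σ₀ = τ • ComplexEmbedding.conjugate σ₀ := by
        rw [← hc, smul_inv_smul]
      rw [smul_conjugate_rt] at h1
      have h2 := congrArg ComplexEmbedding.conjugate h1
      rw [ComplexEmbedding.involutive_conjugate K] at h2
      exact h2.symm

/-- **`τσ₀ ∈ Φ ⟺ τ⁻¹σ₀ ∈ Φ`.** [cite: DinaIonicaSijsling2022, §1.3 Prop. 18 (proof)] [cite: Howard2012, §3.1] -/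
theorem smul_special_mem_iff_inv_smul_special_mem (hk₀ : finrank ℚ k₀ = 2) {Φ : CMType K} {σ₀ : K →+* ℂ}
    (hσ₀ : σ₀ ∈ Φ.1) (hsp : ∀ φ ∈ Φ.1, φ.comp (algebraMap k₀ K) = σ₀.comp (algebraMap k₀ K) → φ = σ₀)
    (τ : ℂ ≃+* ℂ) : τ • σ₀ ∈ Φ.1 ↔ τ⁻¹ • σ₀ ∈ Φ.1 := by
  refine ⟨inv_smul_special_mem_of_smul_special_mem k₀ hk₀ hσ₀ hsp, fun h => ?_⟩
  have := inv_smul_special_mem_of_smul_special_mem k₀ hk₀ hσ₀ hsp h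
  rwa [inv_inv] at this

/-- **`S = S⁻¹`: the lifted type `S = {τ ∈ Aut(ℂ) | τσ₀ ∈ Φ}` at the special base point equals the lifted reflex
type `S* = {τ | τ⁻¹σ₀ ∈ Φ}`** (DIS: «`Φ_L⁻¹ = Φ_L`»). [cite: DinaIonicaSijsling2022, §1.3 Prop. 18 (proof)]
[cite: Shimura1998, §8.3 Prop. 28] -/
theorem typeLift_eq_reflexLift_of_special (hk₀ : finrank ℚ k₀ = 2) {Φ : CMType K} {σ₀ : K →+* ℂ}
    (hσ₀ : σ₀ ∈ Φ.1) (hsp : ∀ φ ∈ Φ.1, φ.comp (algebraMap k₀ K) = σ₀.comp (algebraMap k₀ K) → φ = σ₀) :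
    (typeLift Φ.1 σ₀ : Set (ℂ ≃+* ℂ)) = reflexLift Φ.1 σ₀ := by
  ext τ
  rw [mem_typeLift, mem_reflexLift]
  exact smul_special_mem_iff_inv_smul_special_mem k₀ hk₀ hσ₀ hsp τ

/-- **`(K^r, Φ^r) = (K, Φ)` read through `σ₀`: Shimura's reflex type ON `K` along `σ₀`, seen from the base point
`σ₀` — `{gσ₀ | g⁻¹σ₀ ∈ Φ}` (`reflexTypeOn`) — is `Φ` itself.** [cite: DinaIonicaSijsling2022, §1.3 Props. 16 and 18]
[cite: Shimura1998, §13.1 (7)] [cite: Howard2012, §3.1] -/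
theorem reflexTypeOn_special_self (hk₀ : finrank ℚ k₀ = 2) {Φ : CMType K} {σ₀ : K →+* ℂ} (hσ₀ : σ₀ ∈ Φ.1)
    (hsp : ∀ φ ∈ Φ.1, φ.comp (algebraMap k₀ K) = σ₀.comp (algebraMap k₀ K) → φ = σ₀) :
    reflexTypeOn Φ.1 σ₀ σ₀ = Φ.1 := by
  haveI := isPretransitive_ringEquiv_complex (K := K)
  ext χ
  rw [mem_reflexTypeOn_iff]
  constructor
  · rintro ⟨g, hg, rfl⟩
    exact (smul_special_mem_iff_inv_smul_special_mem k₀ hk₀ hσ₀ hsp g).2 hg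
  · intro hχ
    obtain ⟨g, rfl⟩ := MulAction.exists_smul_eq (ℂ ≃+* ℂ) σ₀ χ
    exact ⟨g, (smul_special_mem_iff_inv_smul_special_mem k₀ hk₀ hσ₀ hsp g).1 hχ, rfl⟩

/-- **DIS Prop. 17 in this form: seen from the base point `aσ₀`, the reflex type on `K` along `σ₀` is the conjugate
type `aΦ`** (whose special element is `aσ₀`). [cite: DinaIonicaSijsling2022, §1.3 Prop. 17]
[cite: Shimura1998, Prop. 19.10 (19.10c)] -/
theorem reflexTypeOn_smul_special (hk₀ : finrank ℚ k₀ = 2) {Φ : CMType K} {σ₀ : K →+* ℂ} (hσ₀ : σ₀ ∈ Φ.1)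
    (hsp : ∀ φ ∈ Φ.1, φ.comp (algebraMap k₀ K) = σ₀.comp (algebraMap k₀ K) → φ = σ₀) (a : ℂ ≃+* ℂ) :
    reflexTypeOn Φ.1 (a • σ₀) σ₀ = (cmTypeSmul a Φ).1 := by
  rw [reflexTypeOn_smul_left, reflexTypeOn_special_self k₀ hk₀ hσ₀ hsp, cmTypeSmul_val]

/-- The reflex type on `K` along `σ₀` seen from ANY base point `τ : K → ℂ` is a Galois conjugate of `Φ`, again with a
special element. [cite: DinaIonicaSijsling2022, §1.3 Prop. 17] -/
theorem exists_reflexTypeOn_eq_cmTypeSmul_of_special (hk₀ : finrank ℚ k₀ = 2) {Φ : CMType K} {σ₀ : K →+* ℂ}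
    (hσ₀ : σ₀ ∈ Φ.1) (hsp : ∀ φ ∈ Φ.1, φ.comp (algebraMap k₀ K) = σ₀.comp (algebraMap k₀ K) → φ = σ₀)
    (τ : K →+* ℂ) : ∃ a : ℂ ≃+* ℂ, a • σ₀ = τ ∧ reflexTypeOn Φ.1 τ σ₀ = (cmTypeSmul a Φ).1 := by
  haveI := isPretransitive_ringEquiv_complex (K := K)
  obtain ⟨a, rfl⟩ := MulAction.exists_smul_eq (ℂ ≃+* ℂ) σ₀ τ
  exact ⟨a, rfl, reflexTypeOn_smul_special k₀ hk₀ hσ₀ hsp a⟩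

/-- `σ₀(x) ∈ K* = ℚ(tr_Φ(K))` for `[K : ℚ] ≥ 6` (`K* = σ₀(K)`, g25-#6). [cite: Howard2012, §3.1] -/
theorem apply_special_mem_traceField (hk₀ : finrank ℚ k₀ = 2) (h6 : 6 ≤ finrank ℚ K) {Φ : CMType K}
    {σ₀ : K →+* ℂ} (hσ₀ : σ₀ ∈ Φ.1)
    (hsp : ∀ φ ∈ Φ.1, φ.comp (algebraMap k₀ K) = σ₀.comp (algebraMap k₀ K) → φ = σ₀) (x : K) :
    σ₀ x ∈ traceField Φ := by
  rw [traceField_eq_fieldRange_of_special k₀ hk₀ h6 hσ₀ hsp]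
  exact AlgHom.mem_fieldRange.2 ⟨x, rfl⟩

/-- **`(K*, Φ*) = (σ₀(K), Φ ∘ σ₀⁻¹)`: the reflex type on the reflex field `K* = ℚ(tr_Φ(K)) = σ₀(K) ⊂ ℂ` (along the
inclusion, seen from `σ₀`) is `Φ` transported by `σ₀ : K ≅ K*`** — an embedding `ψ : K* → ℂ` belongs to it iff
`ψ ∘ σ₀ ∈ Φ`; equivalently it is the carrier of `inducedCMType (σ₀|^{K*}) Φ` (stated under `σ₀(K) ⊆ K*`, which
holds for `[K : ℚ] ≥ 6`, `apply_special_mem_traceField`; DIS Prop. 18 «`(K₂^r, Φ₂^r) = (σ(K), Φσ⁻¹)`»). [cite: DinaIonicaSijsling2022, §1.3 Props. 16 and 18] [cite: Shimura1998, §8.3 Prop. 28, §13.1 (7)]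
[cite: Howard2012, §3.1] -/
theorem reflexTypeOn_special_traceField (hk₀ : finrank ℚ k₀ = 2) {Φ : CMType K} {σ₀ : K →+* ℂ} (hσ₀ : σ₀ ∈ Φ.1)
    (hsp : ∀ φ ∈ Φ.1, φ.comp (algebraMap k₀ K) = σ₀.comp (algebraMap k₀ K) → φ = σ₀)
    (hmem : ∀ x : K, σ₀ x ∈ traceField Φ) :
    reflexTypeOn Φ.1 σ₀ (algebraMap (traceField Φ) ℂ) =
      (inducedCMType (σ₀.codRestrict (traceField Φ) hmem) Φ).1 := by
  haveI : FiniteDimensional ℚ (traceField Φ) := Module.finite_of_finrank_pos (finrank_traceField_pos Φ)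
  haveI : NumberField (traceField Φ) := NumberField.mk
  haveI := isPretransitive_ringEquiv_complex (K := traceField Φ)
  have hcomp : ∀ g : ℂ ≃+* ℂ,
      (g • algebraMap (traceField Φ) ℂ).comp (σ₀.codRestrict (traceField Φ) hmem) = g • σ₀ := fun g =>
    RingHom.ext fun _ => rfl
  ext ψ
  rw [mem_reflexTypeOn_iff, mem_inducedCMType_iff]
  constructor
  · rintro ⟨g, hg, rfl⟩
    rw [hcomp]
    exact (smul_special_mem_iff_inv_smul_special_mem k₀ hk₀ hσ₀ hsp g).2 hg
  · intro hψ
    obtain ⟨g, rfl⟩ := MulAction.exists_smul_eq (ℂ ≃+* ℂ) (algebraMap (traceField Φ) ℂ) ψ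
    rw [hcomp] at hψ
    exact ⟨g, (smul_special_mem_iff_inv_smul_special_mem k₀ hk₀ hσ₀ hsp g).1 hψ, rfl⟩

/-- The same with the membership hypothesis discharged (`[K : ℚ] ≥ 6`): `ψ ∈ Φ*` iff `ψ ∘ σ₀|^{K*} ∈ Φ`.
[cite: DinaIonicaSijsling2022, §1.3 Props. 16 and 18] [cite: Howard2012, §3.1] -/
theorem mem_reflexTypeOn_traceField_iff_of_special (hk₀ : finrank ℚ k₀ = 2) (h6 : 6 ≤ finrank ℚ K) {Φ : CMType K}
    {σ₀ : K →+* ℂ} (hσ₀ : σ₀ ∈ Φ.1)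
    (hsp : ∀ φ ∈ Φ.1, φ.comp (algebraMap k₀ K) = σ₀.comp (algebraMap k₀ K) → φ = σ₀) (ψ : traceField Φ →+* ℂ) :
    ψ ∈ reflexTypeOn Φ.1 σ₀ (algebraMap (traceField Φ) ℂ) ↔
      ψ.comp (σ₀.codRestrict (traceField Φ) (apply_special_mem_traceField k₀ hk₀ h6 hσ₀ hsp)) ∈ Φ.1 := by
  rw [reflexTypeOn_special_traceField k₀ hk₀ hσ₀ hsp (apply_special_mem_traceField k₀ hk₀ h6 hσ₀ hsp),
    mem_inducedCMType_iff]

end Complex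

/-! ## §2 Galois model: `S = S*`, `H* = Stab(j)`, `K*_L = j(K)`, and `reflexCMType ι Φ j = Φ` carried by `j` -/

section Galois

variable {K : Type} [Field K] [NumberField K] [IsCMField K] (k₀ : IntermediateField ℚ K) [IsTotallyComplex k₀]
variable {L : Type} [Field L] [NumberField L] [IsCMField L] [IsGalois ℚ L]

omit [IsCMField K] [IsCMField L] in
/-- The dictionary on one Galois element: `ι ∘ (g ∘ j) = τ ∘ (ι ∘ j)` and `ι ∘ (g⁻¹ ∘ j) = τ⁻¹ ∘ (ι ∘ j)` for the
`τ ∈ Aut(ℂ)` attached to `g ∈ Gal(L/ℚ)` (tree `exists_ringEquiv_forall_algHomEquivRingHomOfNormal_smul`).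
[cite: Shimura1998, §8.3 Prop. 28] -/
private theorem exists_ringEquiv_comp_smul_rt (j : K →ₐ[ℚ] L) (ι : L →+* ℂ) (g : L ≃ₐ[ℚ] L) :
    ∃ τ : ℂ ≃+* ℂ, (∀ χ : K →ₐ[ℚ] L, ι.comp ((g • χ : K →ₐ[ℚ] L) : K →+* L) = τ • ι.comp (χ : K →+* L)) ∧
      ∀ χ : K →ₐ[ℚ] L, ι.comp ((g⁻¹ • χ : K →ₐ[ℚ] L) : K →+* L) = τ⁻¹ • ι.comp (χ : K →+* L) := by
  obtain ⟨τ, hτ⟩ := exists_ringEquiv_forall_algHomEquivRingHomOfNormal_smul j ι g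
  refine ⟨τ, fun χ => ?_, fun χ => ?_⟩
  · have h := hτ χ
    rwa [algHomEquivRingHomOfNormal_apply, algHomEquivRingHomOfNormal_apply] at h
  · have h := hτ (g⁻¹ • χ)
    rw [smul_inv_smul, algHomEquivRingHomOfNormal_apply, algHomEquivRingHomOfNormal_apply] at h
    rw [h, inv_smul_smul]

omit [IsCMField L] in
/-- **`S(Φ_L, j) = S*(Φ_L, j)` in the Galois model** (`Φ_L = algValuedIn ι Φ`, base point `j` with `ι ∘ j = σ₀` the
special element; any degree). [cite: DinaIonicaSijsling2022, §1.3 Prop. 18 (proof: «`Φ_L⁻¹ = Φ_L`»)] [cite: Shimura1998, §8.3 Prop. 28] -/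
theorem typeLift_algValuedIn_eq_reflexLift_of_special (hk₀ : finrank ℚ k₀ = 2) {Φ : CMType K} (j : K →ₐ[ℚ] L)
    (ι : L →+* ℂ) (hσ₀ : ι.comp (j : K →+* L) ∈ Φ.1)
    (hsp : ∀ φ ∈ Φ.1, φ.comp (algebraMap k₀ K) = (ι.comp (j : K →+* L)).comp (algebraMap k₀ K) →
      φ = ι.comp (j : K →+* L)) :
    (typeLift (algValuedIn ι Φ.1) j : Set (L ≃ₐ[ℚ] L)) = reflexLift (algValuedIn ι Φ.1) j := by
  ext g
  obtain ⟨τ, h1, h2⟩ := exists_ringEquiv_comp_smul_rt j ι g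
  rw [mem_typeLift, mem_reflexLift, mem_algValuedIn_iff, mem_algValuedIn_iff, h1 j, h2 j]
  exact smul_special_mem_iff_inv_smul_special_mem k₀ hk₀ hσ₀ hsp τ

omit [IsCMField L] in
/-- **`H* = Stab(Φ_L) = Stab(j) = Gal(L/j(K))`** for a type with special element `ι ∘ j` (`[K : ℚ] ≥ 6`; g25-#6's
`Stab(Φ) = Aut(ℂ/σ₀(K))` through the dictionary). [cite: Howard2012, §3.1] [cite: Shimura1998, §8.3 Prop. 28] -/
theorem stabilizer_algValuedIn_eq_stabilizer_of_special (hk₀ : finrank ℚ k₀ = 2) (h6 : 6 ≤ finrank ℚ K) {Φ : CMType K}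
    (j : K →ₐ[ℚ] L) (ι : L →+* ℂ) (hσ₀ : ι.comp (j : K →+* L) ∈ Φ.1)
    (hsp : ∀ φ ∈ Φ.1, φ.comp (algebraMap k₀ K) = (ι.comp (j : K →+* L)).comp (algebraMap k₀ K) →
      φ = ι.comp (j : K →+* L)) :
    MulAction.stabilizer (L ≃ₐ[ℚ] L) (algValuedIn ι Φ.1) = MulAction.stabilizer (L ≃ₐ[ℚ] L) j := by
  ext g
  obtain ⟨τ, h1, h2⟩ := exists_ringEquiv_comp_smul_rt j ι g
  rw [MulAction.mem_stabilizer_iff, MulAction.mem_stabilizer_iff]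
  constructor
  · intro hg
    have hstab : ∀ χ' : K →+* ℂ, τ • χ' ∈ Φ.1 ↔ χ' ∈ Φ.1 := by
      intro χ'
      obtain ⟨χ, rfl⟩ := (algHomEquivRingHomOfNormal j ι).surjective χ'
      rw [algHomEquivRingHomOfNormal_apply, ← h1 χ, ← mem_algValuedIn_iff, ← mem_algValuedIn_iff]
      conv_lhs => rw [← hg]
      exact Set.smul_mem_smul_set_iff
    have hτσ := (forall_smul_mem_iff_iff_smul_special_eq k₀ hk₀ h6 hσ₀ hsp τ).1 hstab
    apply comp_algHom_injective ι
    change ι.comp ((g • j : K →ₐ[ℚ] L) : K →+* L) = ι.comp (j : K →+* L)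
    rw [h1 j]
    exact hτσ
  · intro hg
    have hτσ : τ • ι.comp (j : K →+* L) = ι.comp (j : K →+* L) := by
      rw [← h1 j, hg]
    have hstab := (forall_smul_mem_iff_iff_smul_special_eq k₀ hk₀ h6 hσ₀ hsp τ).2 hτσ
    ext χ
    rw [Set.mem_smul_set_iff_inv_smul_mem, mem_algValuedIn_iff, mem_algValuedIn_iff, h2 χ]
    have h := hstab (τ⁻¹ • ι.comp (χ : K →+* L))
    rw [smul_inv_smul] at h
    exact h.symm

omit [IsCMField L] in
/-- **`K*_L = j(K)`: in the Galois model the reflex field of a type with special element `ι ∘ j` is the image of `K`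
under `j`** (`[K : ℚ] ≥ 6`). [cite: Howard2012, §3.1] [cite: DinaIonicaSijsling2022, §1.3 Props. 16 and 18]
[cite: Shimura1998, §8.3 Prop. 28] -/
theorem reflexField_algValuedIn_eq_fieldRange_of_special (hk₀ : finrank ℚ k₀ = 2) (h6 : 6 ≤ finrank ℚ K)
    {Φ : CMType K} (j : K →ₐ[ℚ] L) (ι : L →+* ℂ) (hσ₀ : ι.comp (j : K →+* L) ∈ Φ.1)
    (hsp : ∀ φ ∈ Φ.1, φ.comp (algebraMap k₀ K) = (ι.comp (j : K →+* L)).comp (algebraMap k₀ K) →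
      φ = ι.comp (j : K →+* L)) :
    reflexField ℚ L (algValuedIn ι Φ.1) = j.fieldRange := by
  rw [reflexField_eq_fixedField, stabilizer_algValuedIn_eq_stabilizer_of_special k₀ hk₀ h6 j ι hσ₀ hsp,
    fixedField_stabilizer_algHom]

omit [IsCMField L] in
/-- `j(x) ∈ K*_L`. [cite: Howard2012, §3.1] -/
theorem apply_mem_reflexField_of_special (hk₀ : finrank ℚ k₀ = 2) (h6 : 6 ≤ finrank ℚ K) {Φ : CMType K}
    (j : K →ₐ[ℚ] L) (ι : L →+* ℂ) (hσ₀ : ι.comp (j : K →+* L) ∈ Φ.1)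
    (hsp : ∀ φ ∈ Φ.1, φ.comp (algebraMap k₀ K) = (ι.comp (j : K →+* L)).comp (algebraMap k₀ K) →
      φ = ι.comp (j : K →+* L)) (x : K) :
    (j x : L) ∈ reflexField ℚ L (algValuedIn ι Φ.1) := by
  rw [reflexField_algValuedIn_eq_fieldRange_of_special k₀ hk₀ h6 j ι hσ₀ hsp]
  exact AlgHom.mem_fieldRange.2 ⟨x, rfl⟩

omit [IsCMField L] in
/-- **`g|_{K*} ∈ Φ* ⟺ g ∘ j ∈ Φ_L`**: the reflex type `Φ* = {g|_{K*} | g ∈ S*}` (`ReflexPair.reflexType`) consists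
of the restrictions of the `g` with `g ∘ j ∈ Φ_L` (`[K : ℚ] ≥ 6`; `S* = S` and `Stab(ι*) = H* = Stab(j)`).
[cite: Shimura1998, §8.3 Prop. 28] [cite: DinaIonicaSijsling2022, §1.3 Prop. 18] -/
theorem smul_val_mem_reflexType_iff_of_special (hk₀ : finrank ℚ k₀ = 2) (h6 : 6 ≤ finrank ℚ K) {Φ : CMType K}
    (j : K →ₐ[ℚ] L) (ι : L →+* ℂ) (hσ₀ : ι.comp (j : K →+* L) ∈ Φ.1)
    (hsp : ∀ φ ∈ Φ.1, φ.comp (algebraMap k₀ K) = (ι.comp (j : K →+* L)).comp (algebraMap k₀ K) →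
      φ = ι.comp (j : K →+* L)) (g : L ≃ₐ[ℚ] L) :
    g • (reflexField ℚ L (algValuedIn ι Φ.1)).val ∈ reflexType ℚ L (algValuedIn ι Φ.1) j ↔
      g • j ∈ algValuedIn ι Φ.1 := by
  constructor
  · intro h
    obtain ⟨g', hg', hgg'⟩ := (mem_reflexType_iff ℚ L (algValuedIn ι Φ.1) j _).1 h
    have hst : g'⁻¹ * g ∈ MulAction.stabilizer (L ≃ₐ[ℚ] L) (reflexField ℚ L (algValuedIn ι Φ.1)).val := by
      rw [MulAction.mem_stabilizer_iff, mul_smul, ← hgg', inv_smul_smul]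
    rw [stabilizer_val_reflexField ℚ L (algValuedIn ι Φ.1),
      stabilizer_algValuedIn_eq_stabilizer_of_special k₀ hk₀ h6 j ι hσ₀ hsp, MulAction.mem_stabilizer_iff, mul_smul,
      inv_smul_eq_iff] at hst
    rw [hst, ← mem_typeLift (G := L ≃ₐ[ℚ] L), typeLift_algValuedIn_eq_reflexLift_of_special k₀ hk₀ j ι hσ₀ hsp]
    exact hg'
  · intro h
    have hg : g ∈ (reflexLift (algValuedIn ι Φ.1) j : Set (L ≃ₐ[ℚ] L)) := by
      rw [← typeLift_algValuedIn_eq_reflexLift_of_special k₀ hk₀ j ι hσ₀ hsp]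
      exact (mem_typeLift _ _ _).2 h
    exact smul_val_mem_reflexType ℚ L hg

/-- **THE REFLEX CM TYPE IS `Φ` CARRIED TO `K* = j(K)` BY `j`: `reflexCMType ι Φ j = inducedCMType (j|^{K*}) Φ`**
(`[K : ℚ] ≥ 6`) — an embedding `τ : K* → ℂ` lies in the complex reflex type (`ReflexCMType.reflexCMType`) iff
`τ ∘ j|^{K*} ∈ Φ` («`(K^r, Φ^r) = (K, Φ)`», «`(σ(K), Φσ⁻¹)`»). [cite: DinaIonicaSijsling2022, §1.3 Props. 16 and 18]
[cite: Shimura1998, §8.3 Prop. 28] [cite: Howard2012, §3.1] -/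
theorem reflexCMType_eq_inducedCMType_of_special (hk₀ : finrank ℚ k₀ = 2) (h6 : 6 ≤ finrank ℚ K) {Φ : CMType K}
    (j : K →ₐ[ℚ] L) (ι : L →+* ℂ) (hσ₀ : ι.comp (j : K →+* L) ∈ Φ.1)
    (hsp : ∀ φ ∈ Φ.1, φ.comp (algebraMap k₀ K) = (ι.comp (j : K →+* L)).comp (algebraMap k₀ K) →
      φ = ι.comp (j : K →+* L))
    (hmem : ∀ x : K, (j x : L) ∈ reflexField ℚ L (algValuedIn ι Φ.1)) :
    reflexCMType ι Φ j = inducedCMType ((j : K →+* L).codRestrict (reflexField ℚ L (algValuedIn ι Φ.1)) hmem) Φ := by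
  refine Subtype.ext (Set.ext fun τ => ?_)
  obtain ⟨ψ, rfl⟩ := exists_algHom_comp_eq_of_normal (reflexField ℚ L (algValuedIn ι Φ.1)).val ι τ
  obtain ⟨g, rfl⟩ := MulAction.exists_smul_eq (L ≃ₐ[ℚ] L) (reflexField ℚ L (algValuedIn ι Φ.1)).val ψ
  refine (comp_mem_reflexCMType_iff ι Φ j _).trans ?_
  refine (smul_val_mem_reflexType_iff_of_special k₀ hk₀ h6 j ι hσ₀ hsp g).trans ?_
  have hc : (ι.comp ((g • (reflexField ℚ L (algValuedIn ι Φ.1)).val :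
      reflexField ℚ L (algValuedIn ι Φ.1) →ₐ[ℚ] L) : reflexField ℚ L (algValuedIn ι Φ.1) →+* L)).comp
        ((j : K →+* L).codRestrict (reflexField ℚ L (algValuedIn ι Φ.1)) hmem) =
      ι.comp ((g • j : K →ₐ[ℚ] L) : K →+* L) := RingHom.ext fun _ => rfl
  change ι.comp ((g • j : K →ₐ[ℚ] L) : K →+* L) ∈ Φ.1 ↔
    (ι.comp ((g • (reflexField ℚ L (algValuedIn ι Φ.1)).val :
      reflexField ℚ L (algValuedIn ι Φ.1) →ₐ[ℚ] L) : reflexField ℚ L (algValuedIn ι Φ.1) →+* L)).comp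
        ((j : K →+* L).codRestrict (reflexField ℚ L (algValuedIn ι Φ.1)) hmem) ∈ Φ.1
  rw [hc]

/-- The membership form: `ι ∘ g|_{K*} ∈ Φ*_ℂ ⟺ ι ∘ g ∘ j ∈ Φ`. [cite: Shimura1998, §8.3 Prop. 28]
[cite: DinaIonicaSijsling2022, §1.3 Prop. 18] -/
theorem comp_smul_val_mem_reflexCMType_iff_of_special (hk₀ : finrank ℚ k₀ = 2) (h6 : 6 ≤ finrank ℚ K)
    {Φ : CMType K} (j : K →ₐ[ℚ] L) (ι : L →+* ℂ) (hσ₀ : ι.comp (j : K →+* L) ∈ Φ.1)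
    (hsp : ∀ φ ∈ Φ.1, φ.comp (algebraMap k₀ K) = (ι.comp (j : K →+* L)).comp (algebraMap k₀ K) →
      φ = ι.comp (j : K →+* L)) (g : L ≃ₐ[ℚ] L) :
    ι.comp ((g • (reflexField ℚ L (algValuedIn ι Φ.1)).val : reflexField ℚ L (algValuedIn ι Φ.1) →ₐ[ℚ] L) :
        reflexField ℚ L (algValuedIn ι Φ.1) →+* L) ∈ (reflexCMType ι Φ j).1 ↔
      ι.comp ((g • j : K →ₐ[ℚ] L) : K →+* L) ∈ Φ.1 := by
  exact (comp_mem_reflexCMType_iff ι Φ j _).trans (smul_val_mem_reflexType_iff_of_special k₀ hk₀ h6 j ι hσ₀ hsp g)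

end Galois

/-! ## §3 Sextic CM fields with an imaginary quadratic subfield: every primitive type -/

section Sextic

variable {K : Type} [Field K] [NumberField K] [IsCMField K] (k₀ : IntermediateField ℚ K) [IsTotallyComplex k₀]

/-- **DIS Props. 16 & 18 for EVERY primitive type of a sextic `K ⊇ k₀`**: for some member `σ₀ ∈ Φ` (its special
element) `S = S⁻¹` at `σ₀` and the reflex type on `K` along `σ₀` seen from `σ₀` is `Φ` («`(K^r, Φ^r) = (K, Φ)`»).
[cite: DinaIonicaSijsling2022, §1.3 Props. 16 and 18] -/
theorem exists_reflexTypeOn_eq_self_of_isPrimitive_sextic (hk₀ : finrank ℚ k₀ = 2) (h6 : finrank ℚ K = 6)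
    {Φ : CMType K} {φ₀ : K →+* ℂ} (hprim : IsPrimitive (ℂ ≃+* ℂ) Φ.1 φ₀) :
    ∃ σ₀ : K →+* ℂ, σ₀ ∈ Φ.1 ∧ (typeLift Φ.1 σ₀ : Set (ℂ ≃+* ℂ)) = reflexLift Φ.1 σ₀ ∧
      reflexTypeOn Φ.1 σ₀ σ₀ = Φ.1 := by
  obtain ⟨σ₀, hσ₀, hsp⟩ := exists_special_of_isPrimitive_sextic k₀ hk₀ h6 hprim
  exact ⟨σ₀, hσ₀, typeLift_eq_reflexLift_of_special k₀ hk₀ hσ₀ hsp, reflexTypeOn_special_self k₀ hk₀ hσ₀ hsp⟩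

/-- Sextic `K ⊇ k₀`, primitive `Φ`: **the reflex type on `K* = σ₀(K) ⊂ ℂ` is `Φ ∘ σ₀⁻¹`** — `ψ ∈ Φ*` iff
`ψ ∘ σ₀|^{K*} ∈ Φ` («`(K₂^r, Φ₂^r) = (σ(K), Φσ⁻¹)`»). [cite: DinaIonicaSijsling2022, §1.3 Prop. 18] -/
theorem exists_reflexTypeOn_traceField_eq_of_isPrimitive_sextic (hk₀ : finrank ℚ k₀ = 2) (h6 : finrank ℚ K = 6)
    {Φ : CMType K} {φ₀ : K →+* ℂ} (hprim : IsPrimitive (ℂ ≃+* ℂ) Φ.1 φ₀) :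
    ∃ (σ₀ : K →+* ℂ) (hmem : ∀ x : K, σ₀ x ∈ traceField Φ), σ₀ ∈ Φ.1 ∧
      reflexTypeOn Φ.1 σ₀ (algebraMap (traceField Φ) ℂ) =
        (inducedCMType (σ₀.codRestrict (traceField Φ) hmem) Φ).1 := by
  obtain ⟨σ₀, hσ₀, hsp⟩ := exists_special_of_isPrimitive_sextic k₀ hk₀ h6 hprim
  exact ⟨σ₀, apply_special_mem_traceField k₀ hk₀ (by omega) hσ₀ hsp, hσ₀,
    reflexTypeOn_special_traceField k₀ hk₀ hσ₀ hsp _⟩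

end Sextic

end Literature.NumberTheory.ComplexMultiplication

end
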